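import Summits.ResolutionOfSingularities.ResolutionOfSingularities.Theorems.PinchCutClasses
import HarnessLib

/-!
# PinchCutKernels — §K of the decomp-res node «PinchCut» (lens-2 g14 rev 1, sha256 c63212f979e09fcb; CRITIC-LEDGER
rows 97 / 100 CLEARED)

Tree file 2/3, route-independent: the lens's in-Lean bed-row arithmetic sanity examples and the pure-logic kernels
among the classes —
pointwise EXHAUSTION `classGE_or_gen_or_pspecial`, the projections of a pinch-special point onto the g13 / g12 / g10
/ g9 / g11 located classes,
the EXACT cut `seqDimFour_one_iff : SeqDimFour 1 n ⟺ SeqPGen n ∧ SeqPSpec n`, comparison edges with the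
g13/g12/g10/g11 schemas, the isolation,
strata and REG/SING sub-cuts (`seqPSpec_iff_iso`, `seqPSpecNonIso_iff`, `seqPSpecCurve_iff_reg` EXACT), the
pointwise ENGINE kernels
`isCurveExitPt_of_isPinchCurvePt` (M) / `isCurveExitPt_of_isConeCurvePt` (C) landing in g12's `IsCurveExitPt` BY
LETTER, and the assemblies
`pGenRungAt_of_engines` / `pGenRungAt_one` / `pinchGenericRung_of_engines` — VERBATIM (0 sorry).  Everything from
`rungOne_iff` on (`closes*`, the
isolation / leaves cuts of the rung, map and refinement edges) is in `MaxContactCutPinchCut` (file 3/3, as for g13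
`CurveLeafExit`).  Imports `PinchCutClasses`.
(Sources: CossartJannsenSaito2020 Thm. 2.14, Ch. 2, Ch. 8; CossartPiltant2008 Prop. 4.2; CossartPiltant2019 Rem.
3.2; Hironaka1964 Ch. III; Moh1987; Giraud1975; ZariskiSamuelII Ch. VIII.)
-/

open CategoryTheory AlgebraicGeometry TopologicalSpace IsLocalRing
open Literature.AlgebraicGeometry.Resolution
open Summit.ResolutionOfSingularities.ResolutionOfSingularities.Theorems
open Summit.ResolutionOfSingularities.ResolutionOfSingularities.Theorems.WeakOrderReduction
open Summit.ResolutionOfSingularities.ResolutionOfSingularities.Theorems.DeltaFaceCutClasses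
open Summit.ResolutionOfSingularities.ResolutionOfSingularities.Theorems.RelativeDeltaCut
open Summit.ResolutionOfSingularities.ResolutionOfSingularities.Theorems.CurveLeafExit

namespace Summit.ResolutionOfSingularities.ResolutionOfSingularities.Theorems.PinchCut

/-! ### Arithmetic of the bed rows (in-Lean sanity of the exit condition's exponent clauses) -/

example : 4 % 2 = 0 ∧ 0 < 1 ∧ 1 < 2 ∧ 4 / 2 = 2 := by decide      -- ppinch:e2 z² + xy⁴: (E5), q = 2 section blow-ups

example : 9 % 3 = 0 ∧ 0 < 1 ∧ 1 < 3 ∧ 9 / 3 = 3 := by decide      -- ppinch:p3e2 v³ + w⁹u: (E5), q = 3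

example : 2 % 2 = 0 ∧ 0 < 1 ∧ 1 < 2 ∧ 2 / 2 = 1 := by decide      -- FLAT-1 (Whitney z² + xy², monomialcyl): (E5), q = 1

example : 3 % 3 = 0 ∧ 0 < 2 ∧ 2 < 3 := by decide                  -- sub-flat z³ + v²u³: (E5), k = 2

example : 0 < 4 % 3 ∧ 1 + 4 % 3 ≤ 3 := by decide                  -- z³ + vu⁴: (E12) (= g13 (G1ʳ), overlap)

example : ¬ (0 < 2 ∧ 2 < 2) ∧ ¬ (0 < 3 ∧ 3 < 2) := by decide      -- z² + v²u², z² + v³u²: not (E5) (power / deep pinch)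

/-- `IsConePower (ZMod 2) 2 1`: `1 = 1²` and `C(2,1) = 0` in characteristic two — the Whitney face `Z² + 1·V²` IS a
square: the `k = n = 2` pinch `z² + v²u²` is refused by (E34) (indeed `= (z + vu)²`: not even Top-isolated). [folklore] -/
example : IsConePower (ZMod 2) 2 1 :=
  ⟨1, by decide, fun i hi hi2 => by interval_cases i; decide⟩

section Kernels

variable {n : ℕ}

/-! ## §K  Kernels — pure logic (0 sorry) -/

/-- Pointwise EXHAUSTION: a top point is of class ≥ 2, near-generic, δ-generic, curve-generic, rel-curve-generic,
flat-curve, pinch-curve or cone-curve — or pinch-special. [folklore] -/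
theorem classGE_or_gen_or_pspecial {k : Type} [Field k] {Y : Scheme.{0}} (g : Y ⟶ Spec (.of k))
    (hY : Scheme.IsRegular Y) (I : Y.IdealSheafData) (n : ℕ) (y : Y) :
    (ClassGE g hY I n 2 y ∨ VeryNearCutClasses.IsNearGenericPt I n y ∨ IsDeltaGenericPt I n y ∨
        IsCurveGenericPt I n y ∨ IsRelCurveGenericPt I n y ∨ IsFlatCurvePt I n y ∨
        IsPinchCurvePt I n y ∨ IsConeCurvePt I n y) ∨
      IsPinchSpecialPt g hY I n y := by
  rcases CurveLeafExit.classGE_or_gen_or_lspecial g hY I n y with h | h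
  · rcases h with h | h | h | h | h | h
    · exact Or.inl (Or.inl h)
    · exact Or.inl (Or.inr (Or.inl h))
    · exact Or.inl (Or.inr (Or.inr (Or.inl h)))
    · exact Or.inl (Or.inr (Or.inr (Or.inr (Or.inl h))))
    · exact Or.inl (Or.inr (Or.inr (Or.inr (Or.inr (Or.inl h)))))
    · exact Or.inl (Or.inr (Or.inr (Or.inr (Or.inr (Or.inr (Or.inl h))))))
  · by_cases h7 : IsPinchCurvePt I n y
    · exact Or.inl (Or.inr (Or.inr (Or.inr (Or.inr (Or.inr (Or.inr (Or.inl h7)))))))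
    by_cases h8 : IsConeCurvePt I n y
    · exact Or.inl (Or.inr (Or.inr (Or.inr (Or.inr (Or.inr (Or.inr (Or.inr h8)))))))
    · exact Or.inr ⟨h, h7, h8⟩

/-- A pinch-special point is in none of the eight decided classes. [folklore] -/
theorem not_gen_of_isPinchSpecialPt {k : Type} [Field k] {Y : Scheme.{0}} {g : Y ⟶ Spec (.of k)}
    {hY : Scheme.IsRegular Y} {I : Y.IdealSheafData} {n : ℕ} {y : Y} (h : IsPinchSpecialPt g hY I n y) :
    ¬ (ClassGE g hY I n 2 y ∨ VeryNearCutClasses.IsNearGenericPt I n y ∨ IsDeltaGenericPt I n y ∨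
        IsCurveGenericPt I n y ∨ IsRelCurveGenericPt I n y ∨ IsFlatCurvePt I n y ∨
        IsPinchCurvePt I n y ∨ IsConeCurvePt I n y) := by
  rintro (hc | hg | hd | hu | hr | hf | hm | hC)
  · exact h.1.1.1.1 hc
  · exact h.1.1.1.2 hg
  · exact h.1.1.2.1 hd
  · exact h.1.1.2.2 hu
  · exact h.1.2.1 hr
  · exact h.1.2.2 hf
  · exact h.2.1 hm
  · exact h.2.2 hC

/-- A pinch-special point is leaf-special (g13, restated) — projection. [folklore] -/
theorem isLeafSpecialPt_of_isPinchSpecialPt {k : Type} [Field k] {Y : Scheme.{0}} {g : Y ⟶ Spec (.of k)}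
    {hY : Scheme.IsRegular Y} {I : Y.IdealSheafData} {n : ℕ} {y : Y} (h : IsPinchSpecialPt g hY I n y) :
    IsLeafSpecialPt g hY I n y :=
  h.1

/-- A pinch-special point is relatively special (g12, restated). [folklore] -/
theorem isRelSpecialPt_of_isPinchSpecialPt {k : Type} [Field k] {Y : Scheme.{0}} {g : Y ⟶ Spec (.of k)}
    {hY : Scheme.IsRegular Y} {I : Y.IdealSheafData} {n : ℕ} {y : Y} (h : IsPinchSpecialPt g hY I n y) :
    IsRelSpecialPt g hY I n y :=
  h.1.1

/-- A pinch-special point is near-special (g10, tree). [folklore] -/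
theorem isNearSpecialPt_of_isPinchSpecialPt {k : Type} [Field k] {Y : Scheme.{0}} {g : Y ⟶ Spec (.of k)}
    {hY : Scheme.IsRegular Y} {I : Y.IdealSheafData} {n : ℕ} {y : Y} (h : IsPinchSpecialPt g hY I n y) :
    VeryNearCutClasses.IsNearSpecialPt g hY I n y :=
  h.1.1.1

/-- A pinch-special point is face-special (g9, tree). [folklore] -/
theorem isFaceSpecialPt_of_isPinchSpecialPt {k : Type} [Field k] {Y : Scheme.{0}} {g : Y ⟶ Spec (.of k)}
    {hY : Scheme.IsRegular Y} {I : Y.IdealSheafData} {n : ℕ} {y : Y} (h : IsPinchSpecialPt g hY I n y) :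
    FaceFormCutClasses.IsFaceSpecialPt g hY I n y :=
  VeryNearCutKernels.isFaceSpecialPt_of_isNearSpecialPt h.1.1.1

/-- A pinch-special point is δ-special (g11, tree). [folklore] -/
theorem isDeltaSpecialPt_of_isPinchSpecialPt {k : Type} [Field k] {Y : Scheme.{0}} {g : Y ⟶ Spec (.of k)}
    {hY : Scheme.IsRegular Y} {I : Y.IdealSheafData} {n : ℕ} {y : Y} (h : IsPinchSpecialPt g hY I n y) :
    IsDeltaSpecialPt g hY I n y :=
  ⟨isFaceSpecialPt_of_isPinchSpecialPt h, h.1.1.2.1⟩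

/-- A regular clean curve is a clean curve (projection). [folklore] -/
theorem onCleanCurve_of_onRegularCleanCurve {Y : Scheme.{0}} {I : Y.IdealSheafData} {n : ℕ} {y : Y}
    (h : OnRegularCleanCurve I n y) : OnCleanCurve I n y := by
  obtain ⟨η, h1, h2, h3, h4, -⟩ := h
  exact ⟨η, h1, h2, h3, h4⟩

/-- **EXACT at each marking**: `SeqDimFour 1 n ⟺ SeqPGen n ∧ SeqPSpec n` (excluded middle on «some top point is
pinch-special»). [folklore] -/
theorem seqDimFour_one_iff : SeqDimFour 1 n ↔ SeqPGen n ∧ SeqPSpec n := by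
  constructor
  · intro h
    refine ⟨?_, ?_⟩
    · intro p hp k _ _ Y g h1 h2 h3 hY h4 I hord _
      exact h p hp k Y g h1 h2 h3 hY h4 I hord (fun y _ => Or.inl le_rfl)
    · intro p hp k _ _ Y g h1 h2 h3 hY h4 I hord _
      exact h p hp k Y g h1 h2 h3 hY h4 I hord (fun y _ => Or.inl le_rfl)
  · rintro ⟨hG, hS⟩ p hp k _ _ Y g h1 h2 h3 hY h4 I hord _
    by_cases hex : ∃ y : Y, idealOrder I y = ((n : ℕ) : ℕ∞) ∧ IsPinchSpecialPt g hY I n y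
    · exact hS p hp k Y g h1 h2 h3 hY h4 I hord hex
    · refine hG p hp k Y g h1 h2 h3 hY h4 I hord ?_
      intro y hy
      rcases classGE_or_gen_or_pspecial g hY I n y with h | h
      · exact h
      · exact absurd ⟨y, hy, h⟩ hex

/-- The two classes at one marking give all data. [folklore] -/
theorem seqDimFour_one_of_pgen_pspec (hG : SeqPGen n) (hS : SeqPSpec n) : SeqDimFour 1 n :=
  seqDimFour_one_iff.mpr ⟨hG, hS⟩

/-- `SeqPGen n` is `SeqDimFour 1 n` restricted: weaker BY LETTER. [folklore] -/
theorem seqPGen_of_seqDimFour_one (h : SeqDimFour 1 n) : SeqPGen n := (seqDimFour_one_iff.mp h).1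

/-- `SeqPSpec n` is `SeqDimFour 1 n` restricted: weaker BY LETTER. [folklore] -/
theorem seqPSpec_of_seqDimFour_one (h : SeqDimFour 1 n) : SeqPSpec n := (seqDimFour_one_iff.mp h).2

/-- `SeqDimFour 2 n` is `SeqPGen n` restricted. [folklore] -/
theorem seqDimFour_two_of_seqPGen (h : SeqPGen n) : SeqDimFour 2 n := by
  intro p hp k _ _ Y g h1 h2 h3 hY h4 I hord hcls
  exact h p hp k Y g h1 h2 h3 hY h4 I hord (fun y hy => Or.inl (hcls y hy))

/-- g13's decided schema `SeqLGen n` (restated) is `SeqPGen n` restricted (the two new classes ENLARGE the decided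
class). [folklore] -/
theorem seqLGen_of_seqPGen (h : SeqPGen n) : SeqLGen n := by
  intro p hp k _ _ Y g h1 h2 h3 hY h4 I hord hcls
  refine h p hp k Y g h1 h2 h3 hY h4 I hord ?_
  intro y hy
  rcases hcls y hy with h' | h' | h' | h' | h' | h'
  · exact Or.inl h'
  · exact Or.inr (Or.inl h')
  · exact Or.inr (Or.inr (Or.inl h'))
  · exact Or.inr (Or.inr (Or.inr (Or.inl h')))
  · exact Or.inr (Or.inr (Or.inr (Or.inr (Or.inl h'))))
  · exact Or.inr (Or.inr (Or.inr (Or.inr (Or.inr (Or.inl h')))))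

/-- g12's decided schema `SeqRGen n` (restated) is `SeqPGen n` restricted. [folklore] -/
theorem seqRGen_of_seqPGen (h : SeqPGen n) : SeqRGen n :=
  CurveLeafExit.seqRGen_of_seqLGen (seqLGen_of_seqPGen h)

/-- g10's decided schema `SeqNGen n` (tree) is `SeqPGen n` restricted. [folklore] -/
theorem seqNGen_of_seqPGen (h : SeqPGen n) : VeryNearCutClasses.SeqNGen n :=
  CurveLeafExit.seqNGen_of_seqLGen (seqLGen_of_seqPGen h)

/-- g11's decided schema `SeqDGen n` (tree) is `SeqPGen n` restricted. [folklore] -/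
theorem seqDGen_of_seqPGen (h : SeqPGen n) : SeqDGen n :=
  CurveLeafExit.seqDGen_of_seqLGen (seqLGen_of_seqPGen h)

/-- g13's located schema `SeqLSpec n` (restated) gives `SeqPSpec n` (pinch-special ⇒ leaf-special): the located class
SHRINKS by letter. [folklore] -/
theorem seqPSpec_of_seqLSpec (h : SeqLSpec n) : SeqPSpec n := by
  intro p hp k _ _ Y g h1 h2 h3 hY h4 I hord hex
  obtain ⟨y, hy, hs⟩ := hex
  exact h p hp k Y g h1 h2 h3 hY h4 I hord ⟨y, hy, hs.1⟩

/-- g12's located schema `SeqRSpec n` (restated) gives `SeqPSpec n`. [folklore] -/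
theorem seqPSpec_of_seqRSpec (h : SeqRSpec n) : SeqPSpec n :=
  seqPSpec_of_seqLSpec (CurveLeafExit.seqLSpec_of_seqRSpec h)

/-- g10's located schema `SeqNSpec n` (tree) gives `SeqPSpec n`. [folklore] -/
theorem seqPSpec_of_seqNSpec (h : VeryNearCutClasses.SeqNSpec n) : SeqPSpec n :=
  seqPSpec_of_seqLSpec (CurveLeafExit.seqLSpec_of_seqNSpec h)

/-- g11's located schema `SeqDSpec n` (tree) gives `SeqPSpec n`. [folklore] -/
theorem seqPSpec_of_seqDSpec (h : SeqDSpec n) : SeqPSpec n :=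
  seqPSpec_of_seqLSpec (CurveLeafExit.seqLSpec_of_seqDSpec h)

/-- g13's NON-ISOLATED column gives this node's (the column SHRINKS by letter). [folklore] -/
theorem seqPSpecNonIso_of_seqLSpecNonIso (h : SeqLSpecNonIso n) : SeqPSpecNonIso n := by
  intro p hp k _ _ Y g h1 h2 h3 hY h4 I hord hex
  obtain ⟨y, hy, hs, hni⟩ := hex
  exact h p hp k Y g h1 h2 h3 hY h4 I hord ⟨y, hy, hs.1, hni⟩

/-- g11's NON-ISOLATED column (tree) gives this node's. [folklore] -/
theorem seqPSpecNonIso_of_seqDSpecNonIso (h : SeqDSpecNonIso n) : SeqPSpecNonIso n :=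
  seqPSpecNonIso_of_seqLSpecNonIso (CurveLeafExit.seqLSpecNonIso_of_seqDSpecNonIso h)

/-- **g13's CURVE stratum gives this node's** — THE STRATUM THIS NODE CUTS SHRINKS BY LETTER (the pinch-curve and
cone-curve points leave it). [folklore] -/
theorem seqPSpecCurve_of_seqLSpecCurve (h : SeqLSpecCurve n) : SeqPSpecCurve n := by
  intro p hp k _ _ Y g h1 h2 h3 hY h4 I hord hex
  obtain ⟨y, hy, hs, hni, hcl⟩ := hex
  exact h p hp k Y g h1 h2 h3 hY h4 I hord ⟨y, hy, hs.1, hni, hcl⟩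

/-- g12's CURVE stratum (restated) gives this node's (through g13's). [folklore] -/
theorem seqPSpecCurve_of_seqRSpecCurve (h : SeqRSpecCurve n) : SeqPSpecCurve n :=
  seqPSpecCurve_of_seqLSpecCurve (CurveLeafExit.seqLSpecCurve_of_seqRSpecCurve h)

/-- **EXACT isolation sub-cut of the located class**: `SeqPSpec n ⟺ SeqPSpecNonIso n ∧ SeqPSpecIso n`. [folklore] -/
theorem seqPSpec_iff_iso : SeqPSpec n ↔ SeqPSpecNonIso n ∧ SeqPSpecIso n := by
  constructor
  · intro h
    refine ⟨?_, ?_⟩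
    · intro p hp k _ _ Y g h1 h2 h3 hY h4 I hord hex
      obtain ⟨y, hy, hs, -⟩ := hex
      exact h p hp k Y g h1 h2 h3 hY h4 I hord ⟨y, hy, hs⟩
    · intro p hp k _ _ Y g h1 h2 h3 hY h4 I hord hex _
      exact h p hp k Y g h1 h2 h3 hY h4 I hord hex
  · rintro ⟨hN, hI⟩ p hp k _ _ Y g h1 h2 h3 hY h4 I hord hex
    by_cases hni : ∃ y : Y, idealOrder I y = ((n : ℕ) : ℕ∞) ∧ IsPinchSpecialPt g hY I n y ∧
        ¬ FaceFormCutClasses.IsIsolatedTop I n y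
    · exact hN p hp k Y g h1 h2 h3 hY h4 I hord hni
    · refine hI p hp k Y g h1 h2 h3 hY h4 I hord hex ?_
      intro y hy hs
      by_contra hiso
      exact hni ⟨y, hy, hs, hiso⟩

/-- The two isolation columns give the located class (`mpr`, by name for probes). [folklore] -/
theorem seqPSpec_of_iso (hN : SeqPSpecNonIso n) (hI : SeqPSpecIso n) : SeqPSpec n :=
  seqPSpec_iff_iso.mpr ⟨hN, hI⟩

/-- **EXACT sub-cut of the NON-ISOLATED column**: `SeqPSpecNonIso n ⟺ SeqPSpecCurve n ∧ SeqPSpecTangle n`. [folklore] -/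
theorem seqPSpecNonIso_iff : SeqPSpecNonIso n ↔ SeqPSpecCurve n ∧ SeqPSpecTangle n := by
  constructor
  · intro h
    refine ⟨?_, ?_⟩
    · intro p hp k _ _ Y g h1 h2 h3 hY h4 I hord hex
      obtain ⟨y, hy, hs, hni, -⟩ := hex
      exact h p hp k Y g h1 h2 h3 hY h4 I hord ⟨y, hy, hs, hni⟩
    · intro p hp k _ _ Y g h1 h2 h3 hY h4 I hord hex _
      exact h p hp k Y g h1 h2 h3 hY h4 I hord hex
  · rintro ⟨hC, hT⟩ p hp k _ _ Y g h1 h2 h3 hY h4 I hord hex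
    by_cases hcur : ∃ y : Y, idealOrder I y = ((n : ℕ) : ℕ∞) ∧ IsPinchSpecialPt g hY I n y ∧
        ¬ FaceFormCutClasses.IsIsolatedTop I n y ∧ OnCleanCurve I n y
    · exact hC p hp k Y g h1 h2 h3 hY h4 I hord hcur
    · refine hT p hp k Y g h1 h2 h3 hY h4 I hord hex ?_
      intro y hy hs hni hcl
      exact hcur ⟨y, hy, hs, hni, hcl⟩

/-- The two strata give the non-isolated column (`mpr`, by name for probes). [folklore] -/
theorem seqPSpecNonIso_of_strata (hC : SeqPSpecCurve n) (hT : SeqPSpecTangle n) : SeqPSpecNonIso n :=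
  seqPSpecNonIso_iff.mpr ⟨hC, hT⟩

/-- **EXACT sub-cut of the CURVE stratum by the REGULARITY OF THE CENTRE** (NEW): `SeqPSpecCurve n ⟺ SeqPSpecCurveReg n ∧
SeqPSpecCurveSing n` (excluded middle on «some non-isolated pinch-special top point lies on a clean curve regular at it»).
[folklore] -/
theorem seqPSpecCurve_iff_reg : SeqPSpecCurve n ↔ SeqPSpecCurveReg n ∧ SeqPSpecCurveSing n := by
  constructor
  · intro h
    refine ⟨?_, ?_⟩
    · intro p hp k _ _ Y g h1 h2 h3 hY h4 I hord hex
      obtain ⟨y, hy, hs, hni, hreg⟩ := hex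
      exact h p hp k Y g h1 h2 h3 hY h4 I hord ⟨y, hy, hs, hni, onCleanCurve_of_onRegularCleanCurve hreg⟩
    · intro p hp k _ _ Y g h1 h2 h3 hY h4 I hord hex _
      exact h p hp k Y g h1 h2 h3 hY h4 I hord hex
  · rintro ⟨hR, hS⟩ p hp k _ _ Y g h1 h2 h3 hY h4 I hord hex
    by_cases hreg : ∃ y : Y, idealOrder I y = ((n : ℕ) : ℕ∞) ∧ IsPinchSpecialPt g hY I n y ∧
        ¬ FaceFormCutClasses.IsIsolatedTop I n y ∧ OnRegularCleanCurve I n y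
    · exact hR p hp k Y g h1 h2 h3 hY h4 I hord hreg
    · refine hS p hp k Y g h1 h2 h3 hY h4 I hord hex ?_
      intro y hy hs hni _ hr
      exact hreg ⟨y, hy, hs, hni, hr⟩

/-- The two centre strata give the curve stratum (`mpr`, by name for probes). [folklore] -/
theorem seqPSpecCurve_of_centres (hR : SeqPSpecCurveReg n) (hS : SeqPSpecCurveSing n) : SeqPSpecCurve n :=
  seqPSpecCurve_iff_reg.mpr ⟨hR, hS⟩

/-- The located class from its four leaves: CURVE-REGULAR, CURVE-SINGULAR, TANGLE, ISO. [folklore] -/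
theorem seqPSpec_of_leaves (hR : SeqPSpecCurveReg n) (hS : SeqPSpecCurveSing n) (hT : SeqPSpecTangle n)
    (hI : SeqPSpecIso n) : SeqPSpec n :=
  seqPSpec_of_iso (seqPSpecNonIso_of_strata (seqPSpecCurve_of_centres hR hS) hT) hI

/-- ENGINE AT A POINT (vi): the NEW engine (M) `MonomialPinchExit` makes a pinch-curve point a curve-exit point OF g12's
PORT (same conclusion shape `PackageExitsOver`). [folklore] -/
theorem isCurveExitPt_of_isPinchCurvePt {Y : Scheme.{0}} {I : Y.IdealSheafData} {n : ℕ} {y : Y}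
    (hM : MonomialPinchExit) (hY : Scheme.IsRegular Y) (hn : 2 ≤ n) (h : IsPinchCurvePt I n y) :
    IsCurveExitPt I n y := by
  obtain ⟨η, m, hηy, hnm, hiso, hcurve⟩ := h
  exact ⟨η, hηy, hcurve.1, hiso, hM Y hY I n hn η m hnm hcurve⟩

/-- ENGINE AT A POINT (vii): the NEW engine (C) `FlatConeExit` makes a cone-curve point a curve-exit point of g12's
PORT. [folklore] -/
theorem isCurveExitPt_of_isConeCurvePt {Y : Scheme.{0}} {I : Y.IdealSheafData} {n : ℕ} {y : Y}
    (hC : FlatConeExit) (hY : Scheme.IsRegular Y) (hn : 2 ≤ n) (h : IsConeCurvePt I n y) :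
    IsCurveExitPt I n y := by
  obtain ⟨η, hηy, hiso, hcurve⟩ := h
  exact ⟨η, hηy, hcurve.1, hiso, hC Y hY I n hn η hcurve⟩

/-- **THE ENGINES AT WORK (pure logic given the typed pieces)**: the tree engines `VeryNearExit` (g10) and
`DeltaPackageExit` (g11), g12's `UniformCurvePackageExit`, g13's `RelCurvePackageExit` (A) and `NormalConeJumpExit` (B),
the NEW engines `MonomialPinchExit` (M) and `FlatConeExit` (C), and g12's engine-free port `CurvePackagePort n`
UNCHANGED give `PGenRungAt n` for `n ≥ 2`. [folklore] -/
theorem pGenRungAt_of_engines (hV : VeryNearCutClasses.VeryNearExit) (hD : DeltaPackageExit)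
    (hU : UniformCurvePackageExit) (hR : RelCurvePackageExit) (hN : NormalConeJumpExit)
    (hM : MonomialPinchExit) (hC : FlatConeExit) (hP : CurvePackagePort n) (hn : 2 ≤ n) : PGenRungAt n := by
  intro h2 p hp k _ _ Y g hg1 hg2 hg3 hY h4 I hord hcls
  refine hP h2 p hp k Y g hg1 hg2 hg3 hY h4 I hord ?_
  intro y hy
  rcases hcls y hy with h | h | h | h | h | h | h | h
  · exact Or.inl h
  · exact Or.inr (Or.inl (RelativeDeltaCut.isNearExitPt_of_isNearGenericPt hV hY hn h))
  · exact Or.inr (Or.inr (Or.inl (RelativeDeltaCut.isPackageExitPt_of_isDeltaGenericPt hD hY hn hy h)))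
  · exact Or.inr (Or.inr (Or.inr (RelativeDeltaCut.isCurveExitPt_of_isCurveGenericPt hU hY hn h)))
  · exact Or.inr (Or.inr (Or.inr (CurveLeafExit.isCurveExitPt_of_isRelCurveGenericPt hR hY hn h)))
  · exact Or.inr (Or.inr (Or.inr (CurveLeafExit.isCurveExitPt_of_isFlatCurvePt hN hY hn h)))
  · exact Or.inr (Or.inr (Or.inr (isCurveExitPt_of_isPinchCurvePt hM hY hn h)))
  · exact Or.inr (Or.inr (Or.inr (isCurveExitPt_of_isConeCurvePt hC hY hn h)))

/-- At marking `1` every top point is a contact point (tree port `OrderOneContact`), hence of class ≥ 2: `PGenRungAt 1`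
with no blow-up at all. [folklore] -/
theorem pGenRungAt_one (h1 : FaceFormCutClasses.OrderOneContact) : PGenRungAt 1 := by
  intro h2 p hp k _ _ Y g hg1 hg2 hg3 hY h4 I hord _
  refine h2 p hp k Y g hg1 hg2 hg3 hY h4 I hord ?_
  intro y hy
  exact Or.inr (Or.inl (h1 p hp k Y g hg1 hg2 hg3 hY I y hy))

/-- **`PinchGenericRung` is DECIDED modulo the typed pieces**: seven engines, g12's curve port at every marking `≥ 2`,
and the order-one contact port. [folklore] -/
theorem pinchGenericRung_of_engines (hV : VeryNearCutClasses.VeryNearExit) (hD : DeltaPackageExit)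
    (hU : UniformCurvePackageExit) (hR : RelCurvePackageExit) (hN : NormalConeJumpExit)
    (hM : MonomialPinchExit) (hC : FlatConeExit) (hP : ∀ n : ℕ, 2 ≤ n → CurvePackagePort n)
    (h1 : FaceFormCutClasses.OrderOneContact) : PinchGenericRung := by
  intro hE2 n hn
  by_cases h : 2 ≤ n
  · exact pGenRungAt_of_engines hV hD hU hR hN hM hC (hP n h) h (hE2 n hn)
  · have hn1 : n = 1 := by omega
    subst hn1
    exact pGenRungAt_one h1 (hE2 1 hn)

end Kernels

end Summit.ResolutionOfSingularities.ResolutionOfSingularities.Theorems.PinchCut
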